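import Summits.BirchSwinnertonDyer.BirchSwinnertonDyer.Theorems.SignedLowerHalvesKobayashiMainConjectureSmallImageMuTransferUnitPartner
import Summits.BirchSwinnertonDyer.BirchSwinnertonDyer.Theorems.Rank1ResidualX11RankOneReduction
import Summits.BirchSwinnertonDyer.Rank1Residual.Supersingular.NonsplitCartanThreeDescentRecordsX7Three02
import Summits.BirchSwinnertonDyer.Rank1Residual.Supersingular.NonsplitCartanThreeDescentRecordsX7Three03
import Literature.NumberTheory.EllipticCurves.Fisher2012.HesseFamilyThreeCongruenceProofs
import Literature.NumberTheory.EllipticCurves.Fisher2012.HesseFamilyThreeReverseProofs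
import Literature.NumberTheory.EllipticCurves.ComplexMultiplicationLocalFactorsAux
import Literature.NumberTheory.EllipticCurves.PointCountEulerCriterion
import HarnessLib

/-!
# Route `SignedLowerHalves`, crux `KobayashiMainConjectureSmallImage` (item stmt-BirchSwinnertonDyer-19002) —
# L4-W4H per-pair records, file C: Kobayashi's ± main conjecture for rank-0 CM-PARTNERLESS non-surjective pairs whose UNIT PARTNER
# lies BEYOND Cremona's range, found in Fisher's congruence pencils (object «L4-W4H» = the cell's W4″; PUBLISHED named facts +
# displayed certificates — NO preprint, NO CM partner, NO Mazur–Tate congruence)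
# (cell `bsd-ssimc`, seat `bsd-ssimc-k3-c4` gen 8; `--supports stmt-BirchSwinnertonDyer-19002 --as helper`)

HONEST FRAMING: Kobayashi's signed main conjecture at a non-surjective (normaliser-of-non-split-Cartan) image is OPEN as a
class statement; item 4 stays OPEN; nothing here is booked; BSD is not proved by any of this. These are PER-PAIR theorems
for window pairs of item 4 that have NO CM elliptic-curve partner and NO unit partner of conductor `< 5·10⁵` (the typed
remainder of the seat's MEMO-5 §2.1), obtained exactly as g5's records A/B (`…UnitPartnerRecordsA/B.lean`, p463567 /
p464776) but with the partner `A` taken from Fisher's pencils `X_E(3)` / `X_E⁻(3)` of `E` itself (every member is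
`3`-congruent to `E`; Fisher 2012 Thm. 13.2 / §13, tree theorems `threeCongruent_of_{hesse,dualHesse}Certificate_unconditional`):
the seat's kit job enumerates the pencil (LLL-reduced coordinates), keeps the members with good supersingular reduction at `3`
(`a_3 = 0`), `3 ∤ ∏_ℓ c_ℓ`, root number `+1`, `3 ∤ L(A,1)/(Ω_A ∏c/#tors²)` (PARI), and runs the two audited EXACT `3`-descent
engines of the b2b lane UNCHANGED on them (x11b `desc3lib.gp` sha256 c4fb20b7… with `entry.gp` 1efb1f5d…; x11c
`descentPlib.gp` 3b7a8c5e… FULL mode; bundle file `ENGINE_SHA256SUMS`). A HIT is a member with `dim Sel³(A/ℚ) = 0` in mode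
`EXACT(bnfcertify1+3sat)` on engine 1 AND `#Sel³ = 3⁰ exactly [EXACT]` on engine 2. TIER WORD (planner D26-2 (3), seat MEMO-5
§4): these descent lines are **NEW certificate VALUES from the SAME two audited engines, OUTSIDE the audited b2b tables**
(`SS3-3NN-TABLE.md`); the referee prices them. Everything else is g5's mechanism verbatim (class theorem
`kobayashiMainConjecture_of_unitPartner_of_bsdp_of_analyticRank_eq_zero`, file `…SmallImageMuTransferUnitPartner.lean`,
p460153): B. D. Kim 2013 Cor. 3.15 makes `ξ^±(A)(0)` a `3`-adic unit (`#Sel^(3)(A) = 1`, `3 ∤ ∏c(A)`), so `μ(X^±(A)) = 0`;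
B. D. Kim 2009 Cor. 2.13 transfers `μ = 0` along `E[3] ≃ A[3]`; Kobayashi's RATIONAL Kato divisibility becomes integral
(Gauss); with `r_an(E) = 0` and the tree's flag-free `BSD(E,3)` theorem `bsdp3_nn<label>` (binders `hr`, `hs`/`hvs`, `hSel`
passed through and DISPLAYED) the constant-term squeeze gives the EQUALITY for BOTH signs — NO `hMT` (planner D26-2
PRECISION: where `BSDp W 3` is a tree theorem, g5's road is the cleaner record).

Non-kernel inputs per pair, all displayed: Cremona's `r_an = 0` and `#Ш_an` of `E`; the two descent lines of `E` (b2b) and of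
`A` (this seat's kit job, named in each docstring); `∏_ℓ c_ℓ(A)` (PARI `ellglobalred`, same job). PUBLISHED named facts BY
NAME: `h09`, `h12`, `h41`, `hKim`, `h5`, `h3`, `hGZK`, `hmod'`. NO Pollack–Rubin, NO partner `L_p`, NO modular parametrisation,
NO `μ`-certificate, NO preprint binder, NO Mazur–Tate congruence.

PARTITION (cell bsd-ssimc): X7 (A7) × the partnerless item-4 pairs @ 3 listed in §2 — types-the-object-of (per-pair kernel records
at the «published + certificates» tier, certificates NEW / outside the audited tables); closes NONE; 0 census moves.

References: [BDKim2009] Cor. 2.13; [BDKim2013] Cor. 3.15; [Kobayashi2003] Thm. 1.2, 4.1, Conj. (p. 2); [Fisher2012Hessian] Thm. 13.2, §13;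
[Cremona2006]; [Miller2011LMS] Def. 1.1; [SchaeferStoll2004]; [SilvermanAEC2009] V §2. Memo: `HOME/k3c4-MEMO-8.md` (cell bsd-ssimc).
-/

set_option autoImplicit false
set_option linter.dupNamespace false

noncomputable section

open scoped Classical MatrixGroups ModularForm

open CongruenceSubgroup WeierstrassCurve Literature.NumberTheory.EllipticCurves
  Literature.NumberTheory.EllipticCurves.ModularForms
  Literature.NumberTheory.EllipticCurves.Kobayashi2003 ZpExtension
  Literature.NumberTheory.EllipticCurves.GreenbergVatsal2000
  Literature.NumberTheory.EllipticCurves.BDKim2009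
  Literature.NumberTheory.EllipticCurves.Rank1Residual
  Literature.NumberTheory.EllipticCurves.Rank1Residual.Typed
  Literature.NumberTheory.EllipticCurves.Rank1Residual.X11RankOneCertificates
  Literature.NumberTheory.EllipticCurves.Fisher2012
  Summit.BirchSwinnertonDyer.BirchSwinnertonDyer.Rank1Residual.IntModel
  Summit.BirchSwinnertonDyer.BirchSwinnertonDyer.Rank1Residual.X11RankOne
  Summit.BirchSwinnertonDyer.Rank1Residual.X11b
  Summit.BirchSwinnertonDyer.Rank1Residual.Supersingular

namespace Summit.BirchSwinnertonDyer.BirchSwinnertonDyer.Theorems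

/-- `#{Ẽ(𝔽_3)} = 4` for the Cremona model of `126350dm1` = `[1, -1, 1, -51805, -4534803]` (`a_3 = 0`: good SUPERSINGULAR at `3`; kernel count). [cite: SilvermanAEC2009, V §2 (a_p = p + 1 − #Ẽ(𝔽_p))] -/
theorem card_w4h_126350dm1_3 :
    Nat.card (((⟨1, -1, 1, -51805, -4534803⟩ : WeierstrassCurve ℤ).map
      (Int.castRingHom (ZMod 3))).toAffine.Point) = 4 := by
  rw [@WeierstrassCurve.natCard_point_eq_one_add_card (ZMod 3) (@ZMod.instField 3 ⟨by norm_num⟩) _ _ _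
    (by decide +kernel), @card_sol_eq_sum_euler (ZMod 3) (@ZMod.instField 3 ⟨by norm_num⟩) _ _
    (by rw [ZMod.ringChar_zmod_n]; decide), ZMod.card]
  decide +kernel

/-- `#{Ẽ(𝔽_3)} = 4` for the unit partner `A` of `126350dm1` (conductor `10414850`) = `[1, -1, 0, -2563367, 14061132541]` (`a_3 = 0`: good SUPERSINGULAR at `3`; kernel count). [cite: SilvermanAEC2009, V §2 (a_p = p + 1 − #Ẽ(𝔽_p))] -/
theorem card_w4h_u10414850_3 :
    Nat.card (((⟨1, -1, 0, -2563367, 14061132541⟩ : WeierstrassCurve ℤ).map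
      (Int.castRingHom (ZMod 3))).toAffine.Point) = 4 := by
  rw [@WeierstrassCurve.natCard_point_eq_one_add_card (ZMod 3) (@ZMod.instField 3 ⟨by norm_num⟩) _ _ _
    (by decide +kernel), @card_sol_eq_sum_euler (ZMod 3) (@ZMod.instField 3 ⟨by norm_num⟩) _ _
    (by rw [ZMod.ringChar_zmod_n]; decide), ZMod.card]
  decide +kernel

/-- `#{Ẽ(𝔽_3)} = 4` for the Cremona model of `126350dl1` = `[1, -1, 1, 930841320, 52536833073947]` (`a_3 = 0`: good SUPERSINGULAR at `3`; kernel count). [cite: SilvermanAEC2009, V §2 (a_p = p + 1 − #Ẽ(𝔽_p))] -/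
theorem card_w4h_126350dl1_3 :
    Nat.card (((⟨1, -1, 1, 930841320, 52536833073947⟩ : WeierstrassCurve ℤ).map
      (Int.castRingHom (ZMod 3))).toAffine.Point) = 4 := by
  rw [@WeierstrassCurve.natCard_point_eq_one_add_card (ZMod 3) (@ZMod.instField 3 ⟨by norm_num⟩) _ _ _
    (by decide +kernel), @card_sol_eq_sum_euler (ZMod 3) (@ZMod.instField 3 ⟨by norm_num⟩) _ _
    (by rw [ZMod.ringChar_zmod_n]; decide), ZMod.card]
  decide +kernel

/-- `#{Ẽ(𝔽_3)} = 4` for the unit partner `A` of `126350dl1` (conductor `156773275`) = `[0, 0, 1, -10754912000, -420296526274219]` (`a_3 = 0`: good SUPERSINGULAR at `3`; kernel count). [cite: SilvermanAEC2009, V §2 (a_p = p + 1 − #Ẽ(𝔽_p))] -/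
theorem card_w4h_u156773275_3 :
    Nat.card (((⟨0, 0, 1, -10754912000, -420296526274219⟩ : WeierstrassCurve ℤ).map
      (Int.castRingHom (ZMod 3))).toAffine.Point) = 4 := by
  rw [@WeierstrassCurve.natCard_point_eq_one_add_card (ZMod 3) (@ZMod.instField 3 ⟨by norm_num⟩) _ _ _
    (by decide +kernel), @card_sol_eq_sum_euler (ZMod 3) (@ZMod.instField 3 ⟨by norm_num⟩) _ _
    (by rw [ZMod.ringChar_zmod_n]; decide), ZMod.card]
  decide +kernel

/-- `#{Ẽ(𝔽_3)} = 4` for the Cremona model of `126350dk1` = `[1, -1, 1, -336520, -59883893]` (`a_3 = 0`: good SUPERSINGULAR at `3`; kernel count). [cite: SilvermanAEC2009, V §2 (a_p = p + 1 − #Ẽ(𝔽_p))] -/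
theorem card_w4h_126350dk1_3 :
    Nat.card (((⟨1, -1, 1, -336520, -59883893⟩ : WeierstrassCurve ℤ).map
      (Int.castRingHom (ZMod 3))).toAffine.Point) = 4 := by
  rw [@WeierstrassCurve.natCard_point_eq_one_add_card (ZMod 3) (@ZMod.instField 3 ⟨by norm_num⟩) _ _ _
    (by decide +kernel), @card_sol_eq_sum_euler (ZMod 3) (@ZMod.instField 3 ⟨by norm_num⟩) _ _
    (by rw [ZMod.ringChar_zmod_n]; decide), ZMod.card]
  decide +kernel

/-- `#{Ẽ(𝔽_3)} = 4` for the unit partner `A` of `126350dk1` (conductor `2833850`) = `[1, -1, 0, 179758, 9931916]` (`a_3 = 0`: good SUPERSINGULAR at `3`; kernel count). [cite: SilvermanAEC2009, V §2 (a_p = p + 1 − #Ẽ(𝔽_p))] -/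
theorem card_w4h_u2833850_3 :
    Nat.card (((⟨1, -1, 0, 179758, 9931916⟩ : WeierstrassCurve ℤ).map
      (Int.castRingHom (ZMod 3))).toAffine.Point) = 4 := by
  rw [@WeierstrassCurve.natCard_point_eq_one_add_card (ZMod 3) (@ZMod.instField 3 ⟨by norm_num⟩) _ _ _
    (by decide +kernel), @card_sol_eq_sum_euler (ZMod 3) (@ZMod.instField 3 ⟨by norm_num⟩) _ _
    (by rw [ZMod.ringChar_zmod_n]; decide), ZMod.card]
  decide +kernel

/-- `#{Ẽ(𝔽_3)} = 4` for the Cremona model of `189280bt1` = `[0, 0, 0, -617357, -108417556]` (`a_3 = 0`: good SUPERSINGULAR at `3`; kernel count). [cite: SilvermanAEC2009, V §2 (a_p = p + 1 − #Ẽ(𝔽_p))] -/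
theorem card_w4h_189280bt1_3 :
    Nat.card (((⟨0, 0, 0, -617357, -108417556⟩ : WeierstrassCurve ℤ).map
      (Int.castRingHom (ZMod 3))).toAffine.Point) = 4 := by
  rw [@WeierstrassCurve.natCard_point_eq_one_add_card (ZMod 3) (@ZMod.instField 3 ⟨by norm_num⟩) _ _ _
    (by decide +kernel), @card_sol_eq_sum_euler (ZMod 3) (@ZMod.instField 3 ⟨by norm_num⟩) _ _
    (by rw [ZMod.ringChar_zmod_n]; decide), ZMod.card]
  decide +kernel

/-- `#{Ẽ(𝔽_3)} = 4` for the unit partner `A` of `189280bt1` (conductor `2406560`) = `[0, 0, 0, -61392968, 182135553392]` (`a_3 = 0`: good SUPERSINGULAR at `3`; kernel count). [cite: SilvermanAEC2009, V §2 (a_p = p + 1 − #Ẽ(𝔽_p))] -/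
theorem card_w4h_u2406560_3 :
    Nat.card (((⟨0, 0, 0, -61392968, 182135553392⟩ : WeierstrassCurve ℤ).map
      (Int.castRingHom (ZMod 3))).toAffine.Point) = 4 := by
  rw [@WeierstrassCurve.natCard_point_eq_one_add_card (ZMod 3) (@ZMod.instField 3 ⟨by norm_num⟩) _ _ _
    (by decide +kernel), @card_sol_eq_sum_euler (ZMod 3) (@ZMod.instField 3 ⟨by norm_num⟩) _ _
    (by rw [ZMod.ringChar_zmod_n]; decide), ZMod.card]
  decide +kernel

/-- **Kobayashi's ± main conjecture, BOTH signs, for `126350dm1 @ 3`** (Cremona model `[1, -1, 1, -51805, -4534803]`, analytic rank `0`,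
`∏_ℓ c_ℓ(E) = 36`, `#Ш_an = 1`; item-4 pair: X7, `a_3 = 0`, image `3Nn`, NO CM elliptic-curve partner, NO unit partner of conductor
`< 5·10⁵` (seat MEMO-5 §2.1)) **from PUBLISHED named facts + displayed certificates via the UNIT PARTNER `A`** = the member
`(-4645 : 3)` of Fisher's pencil `X_E(3)` of `E` (object «L4-W4H», kit j266992): minimal model
`[1, -1, 0, -2563367, 14061132541]`, `N(A) = 10414850 = 2·5²·19²·577`, local data (PARI `ellglobalred`, same job): 2: I_15, c = 1; 5: III*, c = 2; 19: III, c = 2; 577: I_3, c = 1 — so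
`∏_ℓ c_ℓ(A) = 4` (`3 ∤`), `#A(ℚ)_tors = 1`, `w(A) = +1`, `a_3(A) = 0` (kernel count below), `L(A,1)/(Ω_A·∏c/#tors²) = 4`
(PARI `ellL1`, same job; `3 ∤`). Congruence `E[3] ≃ A[3]` (`Γ_ℚ`-equivariant) as a THEOREM: `E` ≅ the member `(6895 : 3)` of Fisher's
Hesse pencil `X_A(3)` of `A` (scaling `u = 369280/3`; `threeCongruent_of_hesseCertificate_unconditional`, Fisher 2012 Thm. 13.2, identity checked by
`norm_num`). Partner data DISPLAYED: `hSelA` = `#Sel^(3)(A/ℚ) = 1` — **NEW certificate VALUES from the SAME two audited engines, OUTSIDE the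
audited b2b tables** (kit j266992, engines byte-identical to b2b `desc3nnSS`, ENGINE_SHA256SUMS in the job bundle): engine 1 (x11b
`desc3lib.gp` c4fb20b7 + `entry.gp` 1efb1f5d, EXACT mode) row `126350dm1~dir3~-4645~3`: `N = 10414850`, `S = [2, 3, 5, 19, 577]`, `Cl(A) = [12, [12]]` certified, `16` generators, `dim H¹(ℚ,A[3];S) = 2`, **`dimSel3 = 0`** `= expected`, `MATCH`, mode `EXACT(bnfcertify1+3sat)`, PARI analytic-rank datum `[0, 1.43325921563082]`; engine 2 (x11c `descentPlib.gp` 3b7a8c5e FULL mode `p = 3`) row `126350dm1~dir3~-4645~3`: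
`Cl = [12, [12]]`, `Cl_S = [1, []]`, `17`/`16` generators, **`[p=3 full 3Nn] dim Fake(E) = 0 = rank + dim E(Q)[p] => #Sel^3(E/Q) = 3^0 exactly [EXACT] (K_S = 0) => Sha(E/Q)[3] = 0`**, `bnfcertify = 1` — AGREE; `htamA` = `3 ∤ ∏_ℓ c_ℓ(A) = 4` (PARI line above). The pair's own `BSD(E,3)` is the tree's
flag-free `bsdp3_nn126350dm1` (`NonsplitCartanThreeDescentRecordsX7Three02.lean`) through its displayed binders `hr` (`r_an = 0`, Cremona),
`hs`/`hvs` (`#Ш_an`, a `3`-unit), `hSel` (`#Sel^(3)(E/ℚ) = 3^0`, EXACT two-engine `3`-descent of the b2b lane). BY NAME: `h09`, `h12`, `h41`,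
`hKim`, `h5`, `h3`, `hGZK`, `hmod'` — all PUBLISHED. Chain: `kobayashiMainConjecture_of_unitPartner_of_bsdp_of_analyticRank_eq_zero`
(B. D. Kim 2013 Cor. 3.15 on `A` ⟹ `μ(X^±(A)) = 0` ⟹ B. D. Kim 2009 Cor. 2.13 ⟹ `μ(X^±(E)) = 0` ⟹ integral Kato divisibility ⟹
constant-term squeeze). NO CM, NO preprint, NO `μ`-certificate, NO `hMT`. Per pair; item 4 stays OPEN; nothing booked; BSD is not
proved by any of this.
[cite: BDKim2009, Cor. 2.13 (p. 187)] [cite: BDKim2013, Cor. 3.15 (p. 199)] [cite: Kobayashi2003, Thm. 4.1 (p. 8) and Conjecture (p. 2)]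
[cite: Fisher2012Hessian, Thm. 13.2 and §13] [cite: Cremona2006, Table 1 (Cremona label 126350dm1)] -/
theorem kobayashiMainConjecture_u126350dm1_3_of_unitPartner_of_bsdp
    (h09 : cor213_signedMu_eq_zero_iff_of_torsionIso)
    (h12 : Kobayashi2003.thm12_signedSelmerDual_finite_torsion)
    (h41 : Kobayashi2003.thm41_signedCharIdeal_divisibility)
    (hKim : BDKim2013.cor315_signedCharValue_rankZero)
    (h5 : realPeriodRat_eq_unit_mul_plusPeriod) (h3 : realPeriodRat_eq_unit_mul_plusPeriod_three)
    (hGZK : rank_eq_analyticRank_of_analyticRank_le_one) (hmod' : hasEntireLFunction_rat)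
    (W A : WeierstrassCurve ℚ) [W.IsElliptic] [W.IsGloballyMinimal] [A.IsElliptic] [A.IsGloballyMinimal]
    [Fact (Nat.Prime 3)] (hW : W = ⟨1, -1, 1, -51805, -4534803⟩) (hA : A = ⟨1, -1, 0, -2563367, 14061132541⟩)
    (hSelA : Nat.card (A.selmerGroup (3 : ℤ)) = 1) (htamA : ¬ 3 ∣ A.tamagawaProduct)
    (hr : W.analyticRank = 0) {s : ℚ} (hs : shaAn W = (s : ℂ)) (hvs : padicValRat 3 s = 0)
    (hSel : Nat.card (W.selmerGroup (3 : ℤ)) = 3 ^ W.analyticRank) (ε : ℤˣ) :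
    KobayashiMainConjecture W 3 ε := by
  have hIW : integralModelInt W = ⟨1, -1, 1, -51805, -4534803⟩ :=
    integralModelInt_eq_of_map_eq _ (by rw [hW]; ext <;> simp [WeierstrassCurve.map])
  have hIA : integralModelInt A = ⟨1, -1, 0, -2563367, 14061132541⟩ :=
    integralModelInt_eq_of_map_eq _ (by rw [hA]; ext <;> simp [WeierstrassCurve.map])
  have hΔ : (⟨1, -1, 1, -51805, -4534803⟩ : WeierstrassCurve ℤ).Δ = discOf [1, -1, 1, -51805, -4534803] :=
    intCurve_Δ 1 (-1) 1 (-51805) (-4534803)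
  have hΔA : (⟨1, -1, 0, -2563367, 14061132541⟩ : WeierstrassCurve ℤ).Δ = discOf [1, -1, 0, -2563367, 14061132541] :=
    intCurve_Δ 1 (-1) 0 (-2563367) 14061132541
  have hgood : W.HasGoodReductionAtPrime 3 :=
    hasGoodReductionAtPrime_of_not_dvd W 3 (by rw [minimalDiscriminantInt_eq hIW, hΔ]; decide +kernel)
  have hgoodA : A.HasGoodReductionAtPrime 3 :=
    hasGoodReductionAtPrime_of_not_dvd A 3 (by rw [minimalDiscriminantInt_eq hIA, hΔA]; decide +kernel)
  have hap : W.frobeniusTrace 3 = 0 := by rw [frobeniusTrace_eq hIW card_w4h_126350dm1_3]; norm_num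
  have hapA : A.frobeniusTrace 3 = 0 := by rw [frobeniusTrace_eq hIA card_w4h_u10414850_3]; norm_num
  have hc4 : W.c₄ = (2486625 : ℚ) := by
    subst hW; norm_num [WeierstrassCurve.c₄, WeierstrassCurve.b₂, WeierstrassCurve.b₄]
  have hc6 : W.c₆ = (3929259375 : ℚ) := by
    subst hW; norm_num [WeierstrassCurve.c₆, WeierstrassCurve.b₂, WeierstrassCurve.b₄, WeierstrassCurve.b₆]
  have hc4A : A.c₄ = (123041625 : ℚ) := by
    subst hA; norm_num [WeierstrassCurve.c₄, WeierstrassCurve.b₂, WeierstrassCurve.b₄]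
  have hc6A : A.c₆ = (-12148264828125 : ℚ) := by
    subst hA; norm_num [WeierstrassCurve.c₆, WeierstrassCurve.b₂, WeierstrassCurve.b₄, WeierstrassCurve.b₆]
  -- the congruence as a THEOREM: `E` is the member (6895 : 3) of the Hesse pencil `X_A(3)` of `A`, scaling `u = 369280/3`
  have hiso := threeCongruent_of_hesseCertificate_unconditional A W ((6895 : ℚ) / 3) (1 : ℚ) ((369280 : ℚ) / 3)
    (by norm_num) (by rw [hc4A, hc6A, hc4, eval_hesseC4three]; norm_num)
    (by rw [hc4A, hc6A, hc6, eval_hesseC6three]; norm_num)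
  exact kobayashiMainConjecture_of_unitPartner_of_bsdp_of_analyticRank_eq_zero W A 3 h09 h12 h41 hKim h5 h3
    hGZK hmod' (by norm_num) hgood hap hgoodA hapA hiso hSelA htamA hr
    (bsdp3_nn126350dm1 hGZK W hW (hr.trans_le zero_le_one) hs hvs hSel) ε

/-- **Kobayashi's ± main conjecture, BOTH signs, for `126350dl1 @ 3`** (Cremona model `[1, -1, 1, 930841320, 52536833073947]`, analytic rank `0`,
`∏_ℓ c_ℓ(E) = 576`, `#Ш_an = 1`; item-4 pair: X7, `a_3 = 0`, image `3Nn`, NO CM elliptic-curve partner, NO unit partner of conductor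
`< 5·10⁵` (seat MEMO-5 §2.1)) **from PUBLISHED named facts + displayed certificates via the UNIT PARTNER `A`** = the member
`(1 : 0)` of Fisher's DUAL pencil `X_E⁻(3)` of `E` (object «L4-W4H», kit j266992): minimal model
`[0, 0, 1, -10754912000, -420296526274219]`, `N(A) = 156773275 = 5²·19²·29·599`, local data (PARI `ellglobalred`, same job): 5: III*, c = 2; 19: III*, c = 2; 29: I_3, c = 1; 599: I_3, c = 1 — so
`∏_ℓ c_ℓ(A) = 4` (`3 ∤`), `#A(ℚ)_tors = 1`, `w(A) = +1`, `a_3(A) = 0` (kernel count below), `L(A,1)/(Ω_A·∏c/#tors²) = 1`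
(PARI `ellL1`, same job; `3 ∤`). Congruence `E[3] ≃ A[3]` (`Γ_ℚ`-equivariant) as a THEOREM: `E` ≅ the member `(1 : 0)` of Fisher's
DUAL Hesse pencil `X_A⁻(3)` of `A` (scaling `u = 1/178721533500`; `threeCongruent_of_dualHesseCertificate_unconditional`, Fisher 2012 §13, identity checked by
`norm_num`). Partner data DISPLAYED: `hSelA` = `#Sel^(3)(A/ℚ) = 1` — **NEW certificate VALUES from the SAME two audited engines, OUTSIDE the
audited b2b tables** (kit j266992, engines byte-identical to b2b `desc3nnSS`, ENGINE_SHA256SUMS in the job bundle): engine 1 (x11b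
`desc3lib.gp` c4fb20b7 + `entry.gp` 1efb1f5d, EXACT mode) row `126350dl1~dual3~1~0`: `N = 156773275`, `S = [3, 5, 19, 29, 599]`, `Cl(A) = [12, [12]]` certified, `17` generators, `dim H¹(ℚ,A[3];S) = 3`, **`dimSel3 = 0`** `= expected`, `MATCH`, mode `EXACT(bnfcertify1+3sat)`, PARI analytic-rank datum `[0, 0.0593872591853166]`; engine 2 (x11c `descentPlib.gp` 3b7a8c5e FULL mode `p = 3`) row `126350dl1~dual3~1~0`:
`Cl = [12, [12]]`, `Cl_S = [1, []]`, `17` generators, **`[p=3 full 3Nn] dim Fake(E) = 0 = rank + dim E(Q)[p] => #Sel^3(E/Q) = 3^0 exactly [EXACT] (K_S = 0) => Sha(E/Q)[3] = 0`**, `bnfcertify = 1` — AGREE; `htamA` = `3 ∤ ∏_ℓ c_ℓ(A) = 4` (PARI line above). The pair's own `BSD(E,3)` is the tree's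
flag-free `bsdp3_nn126350dl1` (`NonsplitCartanThreeDescentRecordsX7Three02.lean`) through its displayed binders `hr` (`r_an = 0`, Cremona),
`hs`/`hvs` (`#Ш_an`, a `3`-unit), `hSel` (`#Sel^(3)(E/ℚ) = 3^0`, EXACT two-engine `3`-descent of the b2b lane). BY NAME: `h09`, `h12`, `h41`,
`hKim`, `h5`, `h3`, `hGZK`, `hmod'` — all PUBLISHED. Chain: `kobayashiMainConjecture_of_unitPartner_of_bsdp_of_analyticRank_eq_zero`
(B. D. Kim 2013 Cor. 3.15 on `A` ⟹ `μ(X^±(A)) = 0` ⟹ B. D. Kim 2009 Cor. 2.13 ⟹ `μ(X^±(E)) = 0` ⟹ integral Kato divisibility ⟹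
constant-term squeeze). NO CM, NO preprint, NO `μ`-certificate, NO `hMT`. Per pair; item 4 stays OPEN; nothing booked; BSD is not
proved by any of this.
[cite: BDKim2009, Cor. 2.13 (p. 187)] [cite: BDKim2013, Cor. 3.15 (p. 199)] [cite: Kobayashi2003, Thm. 4.1 (p. 8) and Conjecture (p. 2)]
[cite: Fisher2012Hessian, Thm. 13.2 and §13] [cite: Cremona2006, Table 1 (Cremona label 126350dl1)] -/
theorem kobayashiMainConjecture_u126350dl1_3_of_unitPartner_of_bsdp
    (h09 : cor213_signedMu_eq_zero_iff_of_torsionIso)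
    (h12 : Kobayashi2003.thm12_signedSelmerDual_finite_torsion)
    (h41 : Kobayashi2003.thm41_signedCharIdeal_divisibility)
    (hKim : BDKim2013.cor315_signedCharValue_rankZero)
    (h5 : realPeriodRat_eq_unit_mul_plusPeriod) (h3 : realPeriodRat_eq_unit_mul_plusPeriod_three)
    (hGZK : rank_eq_analyticRank_of_analyticRank_le_one) (hmod' : hasEntireLFunction_rat)
    (W A : WeierstrassCurve ℚ) [W.IsElliptic] [W.IsGloballyMinimal] [A.IsElliptic] [A.IsGloballyMinimal]
    [Fact (Nat.Prime 3)] (hW : W = ⟨1, -1, 1, 930841320, 52536833073947⟩) (hA : A = ⟨0, 0, 1, -10754912000, -420296526274219⟩)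
    (hSelA : Nat.card (A.selmerGroup (3 : ℤ)) = 1) (htamA : ¬ 3 ∣ A.tamagawaProduct)
    (hr : W.analyticRank = 0) {s : ℚ} (hs : shaAn W = (s : ℂ)) (hvs : padicValRat 3 s = 0)
    (hSel : Nat.card (W.selmerGroup (3 : ℤ)) = 3 ^ W.analyticRank) (ε : ℤˣ) :
    KobayashiMainConjecture W 3 ε := by
  have hIW : integralModelInt W = ⟨1, -1, 1, 930841320, 52536833073947⟩ :=
    integralModelInt_eq_of_map_eq _ (by rw [hW]; ext <;> simp [WeierstrassCurve.map])
  have hIA : integralModelInt A = ⟨0, 0, 1, -10754912000, -420296526274219⟩ :=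
    integralModelInt_eq_of_map_eq _ (by rw [hA]; ext <;> simp [WeierstrassCurve.map])
  have hΔ : (⟨1, -1, 1, 930841320, 52536833073947⟩ : WeierstrassCurve ℤ).Δ = discOf [1, -1, 1, 930841320, 52536833073947] :=
    intCurve_Δ 1 (-1) 1 930841320 52536833073947
  have hΔA : (⟨0, 0, 1, -10754912000, -420296526274219⟩ : WeierstrassCurve ℤ).Δ = discOf [0, 0, 1, -10754912000, -420296526274219] :=
    intCurve_Δ 0 0 1 (-10754912000) (-420296526274219)
  have hgood : W.HasGoodReductionAtPrime 3 :=
    hasGoodReductionAtPrime_of_not_dvd W 3 (by rw [minimalDiscriminantInt_eq hIW, hΔ]; decide +kernel)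
  have hgoodA : A.HasGoodReductionAtPrime 3 :=
    hasGoodReductionAtPrime_of_not_dvd A 3 (by rw [minimalDiscriminantInt_eq hIA, hΔA]; decide +kernel)
  have hap : W.frobeniusTrace 3 = 0 := by rw [frobeniusTrace_eq hIW card_w4h_126350dl1_3]; norm_num
  have hapA : A.frobeniusTrace 3 = 0 := by rw [frobeniusTrace_eq hIA card_w4h_u156773275_3]; norm_num
  have hc4 : W.c₄ = (-44680383375 : ℚ) := by
    subst hW; norm_num [WeierstrassCurve.c₄, WeierstrassCurve.b₂, WeierstrassCurve.b₄]
  have hc6 : W.c₆ = (-45392024837615625 : ℚ) := by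
    subst hW; norm_num [WeierstrassCurve.c₆, WeierstrassCurve.b₂, WeierstrassCurve.b₄, WeierstrassCurve.b₆]
  have hc4A : A.c₄ = (516235776000 : ℚ) := by
    subst hA; norm_num [WeierstrassCurve.c₄, WeierstrassCurve.b₂, WeierstrassCurve.b₄]
  have hc6A : A.c₆ = (363136198700925000 : ℚ) := by
    subst hA; norm_num [WeierstrassCurve.c₆, WeierstrassCurve.b₂, WeierstrassCurve.b₄, WeierstrassCurve.b₆]
  -- the congruence as a THEOREM: `E` is the member (1 : 0) of the DUAL Hesse pencil `X_A⁻(3)` of `A`, scaling `u = 1/178721533500`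
  have hiso := threeCongruent_of_dualHesseCertificate_unconditional A W (1 : ℚ) (0 : ℚ) ((1 : ℚ) / 178721533500)
    (by norm_num) (by rw [hc4A, hc6A, hc4, eval_hesseD3]; norm_num)
    (by rw [hc4A, hc6A, hc6, eval_hesseC6three]; norm_num)
  exact kobayashiMainConjecture_of_unitPartner_of_bsdp_of_analyticRank_eq_zero W A 3 h09 h12 h41 hKim h5 h3
    hGZK hmod' (by norm_num) hgood hap hgoodA hapA hiso hSelA htamA hr
    (bsdp3_nn126350dl1 hGZK W hW (hr.trans_le zero_le_one) hs hvs hSel) ε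

/-- **Kobayashi's ± main conjecture, BOTH signs, for `126350dk1 @ 3`** (Cremona model `[1, -1, 1, -336520, -59883893]`, analytic rank `0`,
`∏_ℓ c_ℓ(E) = 72`, `#Ш_an = 1`; item-4 pair: X7, `a_3 = 0`, image `3Nn`, NO CM elliptic-curve partner, NO unit partner of conductor
`< 5·10⁵` (seat MEMO-5 §2.1)) **from PUBLISHED named facts + displayed certificates via the UNIT PARTNER `A`** = the member
`(-19855 : 9)` of Fisher's pencil `X_E(3)` of `E` (object «L4-W4H», kit j268836 (sieve: j267853)): minimal model
`[1, -1, 0, 179758, 9931916]`, `N(A) = 2833850 = 2·5²·19²·157`, local data (PARI `ellglobalred`, same job): 2: I_3, c = 1; 5: III*, c = 2; 19: III, c = 2; 157: I_3, c = 1 — so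
`∏_ℓ c_ℓ(A) = 4` (`3 ∤`), `#A(ℚ)_tors = 1`, `w(A) = +1`, `a_3(A) = 0` (kernel count below), `L(A,1)/(Ω_A·∏c/#tors²) = 4`
(PARI `ellL1`, same job; `3 ∤`). Congruence `E[3] ≃ A[3]` (`Γ_ℚ`-equivariant) as a THEOREM: `E` ≅ the member `(3325 : 9)` of Fisher's
Hesse pencil `X_A(3)` of `A` (scaling `u = 31400/9`; `threeCongruent_of_hesseCertificate_unconditional`, Fisher 2012 Thm. 13.2, identity checked by
`norm_num`). Partner data DISPLAYED: `hSelA` = `#Sel^(3)(A/ℚ) = 1` — **NEW certificate VALUES from the SAME two audited engines, OUTSIDE the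
audited b2b tables** (kit j268836 (sieve: j267853), engines byte-identical to b2b `desc3nnSS`, ENGINE_SHA256SUMS in the job bundle): engine 1 (x11b
`desc3lib.gp` c4fb20b7 + `entry.gp` 1efb1f5d, EXACT mode) row `126350dk1~dir3~-19855~9`: `N = 2833850`, `S = [2, 3, 5, 19, 157]`, `Cl(A) = [12, [12]]` certified, `16` generators, `dim H¹(ℚ,A[3];S) = 2`, **`dimSel3 = 0`** `= expected`, `MATCH`, mode `EXACT(bnfcertify1+3sat)`, PARI analytic-rank datum `[0, 2.98382157592009]`; engine 2 (x11c `descentPlib.gp` 3b7a8c5e FULL mode `p = 3`) row `126350dk1~dir3~-19855~9`: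
`Cl = [12, [12]]`, `Cl_S = [1, []]`, **`3344ms`**, `bnfcertify = 1` — AGREE; `htamA` = `3 ∤ ∏_ℓ c_ℓ(A) = 4` (PARI line above). The pair's own `BSD(E,3)` is the tree's
flag-free `bsdp3_nn126350dk1` (`NonsplitCartanThreeDescentRecordsX7Three02.lean`) through its displayed binders `hr` (`r_an = 0`, Cremona),
`hs`/`hvs` (`#Ш_an`, a `3`-unit), `hSel` (`#Sel^(3)(E/ℚ) = 3^0`, EXACT two-engine `3`-descent of the b2b lane). BY NAME: `h09`, `h12`, `h41`,
`hKim`, `h5`, `h3`, `hGZK`, `hmod'` — all PUBLISHED. Chain: `kobayashiMainConjecture_of_unitPartner_of_bsdp_of_analyticRank_eq_zero`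
(B. D. Kim 2013 Cor. 3.15 on `A` ⟹ `μ(X^±(A)) = 0` ⟹ B. D. Kim 2009 Cor. 2.13 ⟹ `μ(X^±(E)) = 0` ⟹ integral Kato divisibility ⟹
constant-term squeeze). NO CM, NO preprint, NO `μ`-certificate, NO `hMT`. Per pair; item 4 stays OPEN; nothing booked; BSD is not
proved by any of this.
[cite: BDKim2009, Cor. 2.13 (p. 187)] [cite: BDKim2013, Cor. 3.15 (p. 199)] [cite: Kobayashi2003, Thm. 4.1 (p. 8) and Conjecture (p. 2)]
[cite: Fisher2012Hessian, Thm. 13.2 and §13] [cite: Cremona2006, Table 1 (Cremona label 126350dk1)] -/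
theorem kobayashiMainConjecture_u126350dk1_3_of_unitPartner_of_bsdp
    (h09 : cor213_signedMu_eq_zero_iff_of_torsionIso)
    (h12 : Kobayashi2003.thm12_signedSelmerDual_finite_torsion)
    (h41 : Kobayashi2003.thm41_signedCharIdeal_divisibility)
    (hKim : BDKim2013.cor315_signedCharValue_rankZero)
    (h5 : realPeriodRat_eq_unit_mul_plusPeriod) (h3 : realPeriodRat_eq_unit_mul_plusPeriod_three)
    (hGZK : rank_eq_analyticRank_of_analyticRank_le_one) (hmod' : hasEntireLFunction_rat)
    (W A : WeierstrassCurve ℚ) [W.IsElliptic] [W.IsGloballyMinimal] [A.IsElliptic] [A.IsGloballyMinimal]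
    [Fact (Nat.Prime 3)] (hW : W = ⟨1, -1, 1, -336520, -59883893⟩) (hA : A = ⟨1, -1, 0, 179758, 9931916⟩)
    (hSelA : Nat.card (A.selmerGroup (3 : ℤ)) = 1) (htamA : ¬ 3 ∣ A.tamagawaProduct)
    (hr : W.analyticRank = 0) {s : ℚ} (hs : shaAn W = (s : ℂ)) (hvs : padicValRat 3 s = 0)
    (hSel : Nat.card (W.selmerGroup (3 : ℤ)) = 3 ^ W.analyticRank) (ε : ℤˣ) :
    KobayashiMainConjecture W 3 ε := by
  have hIW : integralModelInt W = ⟨1, -1, 1, -336520, -59883893⟩ :=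
    integralModelInt_eq_of_map_eq _ (by rw [hW]; ext <;> simp [WeierstrassCurve.map])
  have hIA : integralModelInt A = ⟨1, -1, 0, 179758, 9931916⟩ :=
    integralModelInt_eq_of_map_eq _ (by rw [hA]; ext <;> simp [WeierstrassCurve.map])
  have hΔ : (⟨1, -1, 1, -336520, -59883893⟩ : WeierstrassCurve ℤ).Δ = discOf [1, -1, 1, -336520, -59883893] :=
    intCurve_Δ 1 (-1) 1 (-336520) (-59883893)
  have hΔA : (⟨1, -1, 0, 179758, 9931916⟩ : WeierstrassCurve ℤ).Δ = discOf [1, -1, 0, 179758, 9931916] :=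
    intCurve_Δ 1 (-1) 0 179758 9931916
  have hgood : W.HasGoodReductionAtPrime 3 :=
    hasGoodReductionAtPrime_of_not_dvd W 3 (by rw [minimalDiscriminantInt_eq hIW, hΔ]; decide +kernel)
  have hgoodA : A.HasGoodReductionAtPrime 3 :=
    hasGoodReductionAtPrime_of_not_dvd A 3 (by rw [minimalDiscriminantInt_eq hIA, hΔA]; decide +kernel)
  have hap : W.frobeniusTrace 3 = 0 := by rw [frobeniusTrace_eq hIW card_w4h_126350dk1_3]; norm_num
  have hapA : A.frobeniusTrace 3 = 0 := by rw [frobeniusTrace_eq hIA card_w4h_u2833850_3]; norm_num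
  have hc4 : W.c₄ = (16152945 : ℚ) := by
    subst hW; norm_num [WeierstrassCurve.c₄, WeierstrassCurve.b₂, WeierstrassCurve.b₄]
  have hc6 : W.c₆ = (51812371575 : ℚ) := by
    subst hW; norm_num [WeierstrassCurve.c₆, WeierstrassCurve.b₂, WeierstrassCurve.b₄, WeierstrassCurve.b₆]
  have hc4A : A.c₄ = (-8628375 : ℚ) := by
    subst hA; norm_num [WeierstrassCurve.c₄, WeierstrassCurve.b₂, WeierstrassCurve.b₄]
  have hc6A : A.c₆ = (-8620003125 : ℚ) := by
    subst hA; norm_num [WeierstrassCurve.c₆, WeierstrassCurve.b₂, WeierstrassCurve.b₄, WeierstrassCurve.b₆]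
  -- the congruence as a THEOREM: `E` is the member (3325 : 9) of the Hesse pencil `X_A(3)` of `A`, scaling `u = 31400/9`
  have hiso := threeCongruent_of_hesseCertificate_unconditional A W ((3325 : ℚ) / 9) (1 : ℚ) ((31400 : ℚ) / 9)
    (by norm_num) (by rw [hc4A, hc6A, hc4, eval_hesseC4three]; norm_num)
    (by rw [hc4A, hc6A, hc6, eval_hesseC6three]; norm_num)
  exact kobayashiMainConjecture_of_unitPartner_of_bsdp_of_analyticRank_eq_zero W A 3 h09 h12 h41 hKim h5 h3
    hGZK hmod' (by norm_num) hgood hap hgoodA hapA hiso hSelA htamA hr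
    (bsdp3_nn126350dk1 hGZK W hW (hr.trans_le zero_le_one) hs hvs hSel) ε

/-- **Kobayashi's ± main conjecture, BOTH signs, for `189280bt1 @ 3`** (Cremona model `[0, 0, 0, -617357, -108417556]`, analytic rank `0`,
`∏_ℓ c_ℓ(E) = 72`, `#Ш_an = 1`; item-4 pair: X7, `a_3 = 0`, image `3Nn`, NO CM elliptic-curve partner, NO unit partner of conductor
`< 5·10⁵` (seat MEMO-5 §2.1)) **from PUBLISHED named facts + displayed certificates via the UNIT PARTNER `A`** = the member
`(-42172 : 3)` of Fisher's pencil `X_E(3)` of `E` (object «L4-W4H», kit j268836 (sieve: j267853)): minimal model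
`[0, 0, 0, -61392968, 182135553392]`, `N(A) = 2406560 = 2⁵·5·13²·89`, local data (PARI `ellglobalred`, same job): 2: III*, c = 2; 5: I_6, c = 2; 13: III*, c = 2; 89: I_3, c = 1 — so
`∏_ℓ c_ℓ(A) = 8` (`3 ∤`), `#A(ℚ)_tors = 1`, `w(A) = +1`, `a_3(A) = 0` (kernel count below), `L(A,1)/(Ω_A·∏c/#tors²) = 1`
(PARI `ellL1`, same job; `3 ∤`). Congruence `E[3] ≃ A[3]` (`Γ_ℚ`-equivariant) as a THEOREM: `E` ≅ the member `(285376 : 3)` of Fisher's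
Hesse pencil `X_A(3)` of `A` (scaling `u = 462800/3`; `threeCongruent_of_hesseCertificate_unconditional`, Fisher 2012 Thm. 13.2, identity checked by
`norm_num`). Partner data DISPLAYED: `hSelA` = `#Sel^(3)(A/ℚ) = 1` — **NEW certificate VALUES from the SAME two audited engines, OUTSIDE the
audited b2b tables** (kit j268836 (sieve: j267853), engines byte-identical to b2b `desc3nnSS`, ENGINE_SHA256SUMS in the job bundle): engine 1 (x11b
`desc3lib.gp` c4fb20b7 + `entry.gp` 1efb1f5d, EXACT mode) row `189280bt1~dir3~-42172~3`: `N = 2406560`, `S = [2, 3, 5, 13, 89]`, `Cl(A) = [32, [4, 4, 2]]` certified, `18` generators, `dim H¹(ℚ,A[3];S) = 3`, **`dimSel3 = 0`** `= expected`, `MATCH`, mode `EXACT(bnfcertify1+3sat)`, PARI analytic-rank datum `[0, 0.747525910530442]`; engine 2 (x11c `descentPlib.gp` 3b7a8c5e FULL mode `p = 3`) row `189280bt1~dir3~-42172~3`: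
`Cl = [32, [4, 4, 2]]`, `Cl_S = [1, []]`, **`3776ms`**, `bnfcertify = 1` — AGREE; `htamA` = `3 ∤ ∏_ℓ c_ℓ(A) = 8` (PARI line above). The pair's own `BSD(E,3)` is the tree's
flag-free `bsdp3_nn189280bt1` (`NonsplitCartanThreeDescentRecordsX7Three03.lean`) through its displayed binders `hr` (`r_an = 0`, Cremona),
`hs`/`hvs` (`#Ш_an`, a `3`-unit), `hSel` (`#Sel^(3)(E/ℚ) = 3^0`, EXACT two-engine `3`-descent of the b2b lane). BY NAME: `h09`, `h12`, `h41`,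
`hKim`, `h5`, `h3`, `hGZK`, `hmod'` — all PUBLISHED. Chain: `kobayashiMainConjecture_of_unitPartner_of_bsdp_of_analyticRank_eq_zero`
(B. D. Kim 2013 Cor. 3.15 on `A` ⟹ `μ(X^±(A)) = 0` ⟹ B. D. Kim 2009 Cor. 2.13 ⟹ `μ(X^±(E)) = 0` ⟹ integral Kato divisibility ⟹
constant-term squeeze). NO CM, NO preprint, NO `μ`-certificate, NO `hMT`. Per pair; item 4 stays OPEN; nothing booked; BSD is not
proved by any of this.
[cite: BDKim2009, Cor. 2.13 (p. 187)] [cite: BDKim2013, Cor. 3.15 (p. 199)] [cite: Kobayashi2003, Thm. 4.1 (p. 8) and Conjecture (p. 2)]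
[cite: Fisher2012Hessian, Thm. 13.2 and §13] [cite: Cremona2006, Table 1 (Cremona label 189280bt1)] -/
theorem kobayashiMainConjecture_u189280bt1_3_of_unitPartner_of_bsdp
    (h09 : cor213_signedMu_eq_zero_iff_of_torsionIso)
    (h12 : Kobayashi2003.thm12_signedSelmerDual_finite_torsion)
    (h41 : Kobayashi2003.thm41_signedCharIdeal_divisibility)
    (hKim : BDKim2013.cor315_signedCharValue_rankZero)
    (h5 : realPeriodRat_eq_unit_mul_plusPeriod) (h3 : realPeriodRat_eq_unit_mul_plusPeriod_three)
    (hGZK : rank_eq_analyticRank_of_analyticRank_le_one) (hmod' : hasEntireLFunction_rat)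
    (W A : WeierstrassCurve ℚ) [W.IsElliptic] [W.IsGloballyMinimal] [A.IsElliptic] [A.IsGloballyMinimal]
    [Fact (Nat.Prime 3)] (hW : W = ⟨0, 0, 0, -617357, -108417556⟩) (hA : A = ⟨0, 0, 0, -61392968, 182135553392⟩)
    (hSelA : Nat.card (A.selmerGroup (3 : ℤ)) = 1) (htamA : ¬ 3 ∣ A.tamagawaProduct)
    (hr : W.analyticRank = 0) {s : ℚ} (hs : shaAn W = (s : ℂ)) (hvs : padicValRat 3 s = 0)
    (hSel : Nat.card (W.selmerGroup (3 : ℤ)) = 3 ^ W.analyticRank) (ε : ℤˣ) :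
    KobayashiMainConjecture W 3 ε := by
  have hIW : integralModelInt W = ⟨0, 0, 0, -617357, -108417556⟩ :=
    integralModelInt_eq_of_map_eq _ (by rw [hW]; ext <;> simp [WeierstrassCurve.map])
  have hIA : integralModelInt A = ⟨0, 0, 0, -61392968, 182135553392⟩ :=
    integralModelInt_eq_of_map_eq _ (by rw [hA]; ext <;> simp [WeierstrassCurve.map])
  have hΔ : (⟨0, 0, 0, -617357, -108417556⟩ : WeierstrassCurve ℤ).Δ = discOf [0, 0, 0, -617357, -108417556] :=
    intCurve_Δ 0 0 0 (-617357) (-108417556)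
  have hΔA : (⟨0, 0, 0, -61392968, 182135553392⟩ : WeierstrassCurve ℤ).Δ = discOf [0, 0, 0, -61392968, 182135553392] :=
    intCurve_Δ 0 0 0 (-61392968) 182135553392
  have hgood : W.HasGoodReductionAtPrime 3 :=
    hasGoodReductionAtPrime_of_not_dvd W 3 (by rw [minimalDiscriminantInt_eq hIW, hΔ]; decide +kernel)
  have hgoodA : A.HasGoodReductionAtPrime 3 :=
    hasGoodReductionAtPrime_of_not_dvd A 3 (by rw [minimalDiscriminantInt_eq hIA, hΔA]; decide +kernel)
  have hap : W.frobeniusTrace 3 = 0 := by rw [frobeniusTrace_eq hIW card_w4h_189280bt1_3]; norm_num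
  have hapA : A.frobeniusTrace 3 = 0 := by rw [frobeniusTrace_eq hIA card_w4h_u2406560_3]; norm_num
  have hc4 : W.c₄ = (29633136 : ℚ) := by
    subst hW; norm_num [WeierstrassCurve.c₄, WeierstrassCurve.b₂, WeierstrassCurve.b₄]
  have hc6 : W.c₆ = (93672768384 : ℚ) := by
    subst hW; norm_num [WeierstrassCurve.c₆, WeierstrassCurve.b₂, WeierstrassCurve.b₄, WeierstrassCurve.b₆]
  have hc4A : A.c₄ = (2946862464 : ℚ) := by
    subst hA; norm_num [WeierstrassCurve.c₄, WeierstrassCurve.b₂, WeierstrassCurve.b₄]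
  have hc6A : A.c₆ = (-157365118130688 : ℚ) := by
    subst hA; norm_num [WeierstrassCurve.c₆, WeierstrassCurve.b₂, WeierstrassCurve.b₄, WeierstrassCurve.b₆]
  -- the congruence as a THEOREM: `E` is the member (285376 : 3) of the Hesse pencil `X_A(3)` of `A`, scaling `u = 462800/3`
  have hiso := threeCongruent_of_hesseCertificate_unconditional A W ((285376 : ℚ) / 3) (1 : ℚ) ((462800 : ℚ) / 3)
    (by norm_num) (by rw [hc4A, hc6A, hc4, eval_hesseC4three]; norm_num)
    (by rw [hc4A, hc6A, hc6, eval_hesseC6three]; norm_num)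
  exact kobayashiMainConjecture_of_unitPartner_of_bsdp_of_analyticRank_eq_zero W A 3 h09 h12 h41 hKim h5 h3
    hGZK hmod' (by norm_num) hgood hap hgoodA hapA hiso hSelA htamA hr
    (bsdp3_nn189280bt1 hGZK W hW (hr.trans_le zero_le_one) hs hvs hSel) ε

end Summit.BirchSwinnertonDyer.BirchSwinnertonDyer.Theorems

end
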